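import Mathlib
import Summits.ValiantsHypothesis.ValiantsHypothesis.Theorems.GrenetZeonPolySizeQPAlgebraResidualCorankTwo
import HarnessLib

/-!
# Crux `GrenetZeon.PolySizeQPAlgebra` (stmt-ValiantsHypothesis-8064), line `vbp-slice-dealg` —
# the maximal-minor transport: any point ⟶ a normal form `diag(1_κ, S)` with `S ∈ Mat_q(𝔪)`

`…ResidualCorankTwo` transports a value matrix `A(p)` with SOME unit `(n-2)`-minor to `diag(1, S)`,
`S ∈ Mat₂(R)` singular — enough for `q = 2` because `AL(2)` holds for every singular `S`.  The analyses of
residual corank `q ≥ 3` (`…BlockNormalFormGeneral`, `…SquareZeroIdeal`, the inequalities `AL(q)`/G of the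
hand memos) use that the residual block has entries in the maximal ideal, which requires transporting along
a MAXIMAL residually non-vanishing minor.  This file provides that transport for a residual block of any
size, as a reduction principle:

* `exists_equiv_sum_of_injective` — `ι ≃ κ ⊕ m` along an injection `κ → ι` (`|ι| = |κ| + |m|`).
* `blockNormalForm_eq_general` — block Gaussian elimination with a complementary block of any size.
* `schurComplement_apply_eq_zero` — if `φ(det B₁₁) ≠ 0` and `φ` kills every minor bordering `B₁₁` by one
  row and one column, then `φ` kills the Schur complement `B₂₂ - B₂₁B₁₁⁻¹B₁₂` (bordered minor
  `= det B₁₁ · S_{ab}`, `Matrix.det_fromBlocks₁₁` with a `Unit` block).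
* `rank_hess0_transl_le_of_maximal_minor` — **the transport**: for a character `φ` with nilpotent kernel,
  an affine `A` with read-out `F = λ(det A)`, a point `p` and a residually maximal minor `(r, c)` of
  `A(p)` (`φ(det) ≠ 0`, all bordered minors killed by `φ`), every bound on `rank Hess` valid for all
  read-outs of `F` through affine `A'` with `A'(p) = diag(1_κ, S)`, `S ∈ Mat_m(ker φ)`, `|ι| = |κ| + |m|`,
  bounds `rank Hess F(p)` (the elimination matrices are constants: `A' = P·A·Q` is affine, `F` is its
  read-out through `λ ∘ (u⁻¹ ·)`, `u = ± det P` a unit).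

HONEST FRAMING: a reduction principle; no stub of the line is closed; VP ≠ VNP is not moved.

References: T. Mignon, N. Ressayre, IMRN 2004:79, §2 [MignonRessayre2004].
-/

noncomputable section

open MvPolynomial Matrix
open Literature.Computability.AlgebraicComplexity

-- single-conjunct layout `Summits/ValiantsHypothesis/ValiantsHypothesis`: duplicated namespace by design
set_option linter.dupNamespace false

namespace Summit.ValiantsHypothesis.ValiantsHypothesis.Theorems.GrenetZeonPolySizeQPAlgebra

/-! ### Index bookkeeping for a residual block of any size -/

section EquivGeneral

variable {ι κ m : Type*} [Fintype ι] [Fintype κ] [Fintype m] [DecidableEq ι]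

/-- An injection `r : κ → ι` whose image misses exactly `|m|` points extends to an equivalence
`ι ≃ κ ⊕ m` sending `r i` to `inl i`. [folklore] -/
theorem exists_equiv_sum_of_injective (r : κ → ι) (hr : Function.Injective r)
    (hcard : Fintype.card ι = Fintype.card κ + Fintype.card m) :
    ∃ e : ι ≃ κ ⊕ m, ∀ i, e (r i) = Sum.inl i := by
  classical
  have hc : Fintype.card {x // x ∉ Set.range r} = Fintype.card m := by
    rw [Fintype.card_subtype_compl, Set.card_range_of_injective hr, hcard]
    simp
  let e₂ : {x // x ∉ Set.range r} ≃ m := Fintype.equivOfCardEq hc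
  let e₁ : {x // x ∈ Set.range r} ≃ κ := (Equiv.ofInjective r hr).symm
  refine ⟨(Equiv.sumCompl (· ∈ Set.range r)).symm.trans (e₁.sumCongr e₂), fun i => ?_⟩
  rw [Equiv.trans_apply, Equiv.sumCompl_symm_apply_of_pos (p := (· ∈ Set.range r)) ⟨i, rfl⟩,
    Equiv.sumCongr_apply, Sum.map_inl]
  congr 1
  exact Equiv.ofInjective_symm_apply hr i

end EquivGeneral

/-! ### Block elimination with a residual block of any size -/

section NormalFormGeneral

variable {R : Type*} [CommRing R] {κ m : Type*} [Fintype κ] [DecidableEq κ] [Fintype m] [DecidableEq m]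

/-- Block Gaussian elimination `P (B₁₁ B₁₂; B₂₁ B₂₂) Q = diag(1, B₂₂ - B₂₁B₁₁⁻¹B₁₂)` for an invertible
corner `B₁₁` and a complementary block of any size. [folklore] -/
theorem blockNormalForm_eq_general (B₁₁ : Matrix κ κ R) [Invertible B₁₁] (B₁₂ : Matrix κ m R)
    (B₂₁ : Matrix m κ R) (B₂₂ : Matrix m m R) :
    Matrix.fromBlocks (⅟B₁₁) 0 (-(B₂₁ * ⅟B₁₁)) 1 * Matrix.fromBlocks B₁₁ B₁₂ B₂₁ B₂₂ *
        Matrix.fromBlocks 1 (-(⅟B₁₁ * B₁₂)) 0 1 =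
      Matrix.fromBlocks 1 0 0 (B₂₂ - B₂₁ * ⅟B₁₁ * B₁₂) := by
  rw [Matrix.fromBlocks_multiply, Matrix.fromBlocks_multiply]
  simp only [Matrix.zero_mul, Matrix.mul_zero, add_zero, Matrix.one_mul, Matrix.mul_one,
    invOf_mul_self, Matrix.neg_mul, Matrix.invOf_mul_cancel_right, neg_add_cancel, Matrix.mul_neg,
    neg_add_eq_sub, sub_zero]

omit [Fintype m] [DecidableEq m] in
/-- **The residual block lies in the maximal ideal when the corner minor is maximal.**  If
`φ(det B₁₁) ≠ 0` and every minor of `B = (B₁₁ B₁₂; B₂₁ B₂₂)` bordering `B₁₁` by one row `a` and one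
column `b` is killed by the ring map `φ`, then `φ` kills the Schur complement `B₂₂ - B₂₁B₁₁⁻¹B₁₂`
(the bordered minor is `det B₁₁ · (B₂₂ - B₂₁B₁₁⁻¹B₁₂)_{ab}`). [folklore] -/
theorem schurComplement_apply_eq_zero {K : Type*} [Field K] (φ : R →+* K) (B₁₁ : Matrix κ κ R)
    [Invertible B₁₁] (B₁₂ : Matrix κ m R) (B₂₁ : Matrix m κ R) (B₂₂ : Matrix m m R)
    (hu : φ B₁₁.det ≠ 0)
    (hmax : ∀ a b : m, φ (Matrix.fromBlocks B₁₁ (Matrix.of fun i (_ : Unit) => B₁₂ i b)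
      (Matrix.of fun (_ : Unit) j => B₂₁ a j) (Matrix.of fun (_ _ : Unit) => B₂₂ a b)).det = 0)
    (a b : m) : φ ((B₂₂ - B₂₁ * ⅟B₁₁ * B₁₂) a b) = 0 := by
  have h := hmax a b
  rw [Matrix.det_fromBlocks₁₁, map_mul] at h
  have h2 := (mul_eq_zero.1 h).resolve_left hu
  rw [Matrix.det_unique] at h2
  convert h2 using 2
  simp only [Matrix.sub_apply, Matrix.mul_apply, Matrix.of_apply, PUnit.default_eq_unit]

end NormalFormGeneral

/-! ### The maximal-minor transport -/

section MaximalMinor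

variable {ι κ m σ : Type*} [Fintype ι] [DecidableEq ι] [Fintype κ] [DecidableEq κ] [Fintype m]
  [DecidableEq m] [Fintype σ] {R : Type*} [CommRing R] [Algebra ℂ R]

/-- **Maximal-minor transport.**  Let `φ` be a character of `R` with nilpotent kernel, `A` affine with
read-out `F = λ(det A)`, `p` a point, and `(r, c)` the rows and columns of a minor of the value matrix
`B = A(p)` that is MAXIMAL residually: `φ(det B_{rc}) ≠ 0` and every minor bordering it by one row and
one column is killed by `φ`.  Then any bound `N` on `rank Hess` valid for all read-outs of `F` through
affine matrices `A'` (index `κ ⊕ m`, `|ι| = |κ| + |m|`) whose value at `p` is a normal form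
`diag(1_κ, S)` with `S ∈ Mat_m(ker φ)` is a bound for `rank Hess F(p)`.  (Block Gaussian elimination by
constant matrices as in `…ResidualCorankTwo`; the residual block lies in `ker φ` by
`schurComplement_apply_eq_zero`.) [cite: MignonRessayre2004, §2] -/
theorem rank_hess0_transl_le_of_maximal_minor (φ : R →ₐ[ℂ] ℂ) {ν : ℕ}
    (hker : RingHom.ker (φ : R →+* ℂ) ^ ν = ⊥) (l : R →ₗ[ℂ] ℂ) (A : Matrix ι ι (MvPolynomial σ R))
    (F : MvPolynomial σ ℂ) (hA : ∀ a b, (A a b).totalDegree ≤ 1)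
    (hF : ∀ d, l (coeff d A.det) = coeff d F) (p : σ → ℂ) (r c : κ → ι)
    (hu : φ ((A.map (eval fun i => algebraMap ℂ R (p i))).submatrix r c).det ≠ 0)
    (hmax : ∀ a b : ι, φ ((A.map (eval fun i => algebraMap ℂ R (p i))).submatrix
      (Sum.elim r fun _ : Unit => a) (Sum.elim c fun _ : Unit => b)).det = 0)
    (hcard : Fintype.card ι = Fintype.card κ + Fintype.card m) {N : ℕ}
    (H : ∀ (l' : R →ₗ[ℂ] ℂ) (A' : Matrix (κ ⊕ m) (κ ⊕ m) (MvPolynomial σ R)) (S : Matrix m m R),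
      (∀ a b, (A' a b).totalDegree ≤ 1) → (∀ d, l' (coeff d A'.det) = coeff d F) →
      A'.map (eval fun i => algebraMap ℂ R (p i)) = Matrix.fromBlocks 1 0 0 S →
      (∀ i j, φ (S i j) = 0) → (hess0 (transl p F)).rank ≤ N) :
    (hess0 (transl p F)).rank ≤ N := by
  classical
  haveI : Nontrivial R := RingHom.domain_nontrivial (φ : R →+* ℂ)
  set x : σ → R := fun i => algebraMap ℂ R (p i) with hx
  set B : Matrix ι ι R := A.map (eval x) with hB
  have hunit : IsUnit (B.submatrix r c).det := isUnit_of_apply_ne_zero φ hker hu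
  -- the rows `r` and columns `c` are injective
  have hr : Function.Injective r := by
    intro i j hij
    by_contra hne
    have h0 : (B.submatrix r c).det = 0 :=
      Matrix.det_zero_of_row_eq hne (funext fun k => by simp only [Matrix.submatrix_apply, hij])
    exact not_isUnit_zero (h0 ▸ hunit)
  have hc : Function.Injective c := by
    intro i j hij
    by_contra hne
    have h0 : (B.submatrix r c).det = 0 :=
      Matrix.det_zero_of_column_eq hne (fun k => by simp only [Matrix.submatrix_apply, hij])
    exact not_isUnit_zero (h0 ▸ hunit)
  obtain ⟨eR, heR⟩ := exists_equiv_sum_of_injective (m := m) r hr hcard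
  obtain ⟨eC, heC⟩ := exists_equiv_sum_of_injective (m := m) c hc hcard
  have hsR : ∀ i, eR.symm (Sum.inl i) = r i := fun i => by
    rw [Equiv.symm_apply_eq]; exact (heR i).symm
  have hsC : ∀ i, eC.symm (Sum.inl i) = c i := fun i => by
    rw [Equiv.symm_apply_eq]; exact (heC i).symm
  -- the reindexed value matrix and its invertible corner
  set B' : Matrix (κ ⊕ m) (κ ⊕ m) R := Matrix.reindex eR eC B with hB'
  have h11 : B'.toBlocks₁₁ = B.submatrix r c := by
    ext i j
    simp only [hB', Matrix.toBlocks₁₁, Matrix.of_apply, Matrix.reindex_apply, Matrix.submatrix_apply,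
      hsR, hsC]
  letI : Invertible B'.toBlocks₁₁ := Matrix.invertibleOfIsUnitDet _ (by rw [h11]; exact hunit)
  set P : Matrix (κ ⊕ m) (κ ⊕ m) R :=
    Matrix.fromBlocks (⅟B'.toBlocks₁₁) 0 (-(B'.toBlocks₂₁ * ⅟B'.toBlocks₁₁)) 1 with hP
  set Q : Matrix (κ ⊕ m) (κ ⊕ m) R :=
    Matrix.fromBlocks 1 (-(⅟B'.toBlocks₁₁ * B'.toBlocks₁₂)) 0 1 with hQ
  set S : Matrix m m R := B'.toBlocks₂₂ - B'.toBlocks₂₁ * ⅟B'.toBlocks₁₁ * B'.toBlocks₁₂ with hSdef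
  have hPBQ : P * B' * Q = Matrix.fromBlocks 1 0 0 S := by
    have h := blockNormalForm_eq_general B'.toBlocks₁₁ B'.toBlocks₁₂ B'.toBlocks₂₁ B'.toBlocks₂₂
    rwa [Matrix.fromBlocks_toBlocks] at h
  have hPdet : P.det = (⅟B'.toBlocks₁₁).det := by
    rw [hP, Matrix.det_fromBlocks_zero₁₂, Matrix.det_one, mul_one]
  have hQdet : Q.det = 1 := by
    rw [hQ, Matrix.det_fromBlocks_zero₂₁, Matrix.det_one, Matrix.det_one, mul_one]
  -- the residual block is killed by `φ`
  have hSφ : ∀ i j, φ (S i j) = 0 := by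
    intro a b
    refine schurComplement_apply_eq_zero (φ : R →+* ℂ) B'.toBlocks₁₁ B'.toBlocks₁₂ B'.toBlocks₂₁
      B'.toBlocks₂₂ (by rw [h11]; exact hu) (fun a' b' => ?_) a b
    have hmat : Matrix.fromBlocks B'.toBlocks₁₁ (Matrix.of fun i (_ : Unit) => B'.toBlocks₁₂ i b')
        (Matrix.of fun (_ : Unit) j => B'.toBlocks₂₁ a' j) (Matrix.of fun (_ _ : Unit) => B'.toBlocks₂₂ a' b') =
        B.submatrix (Sum.elim r fun _ : Unit => eR.symm (Sum.inr a'))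
          (Sum.elim c fun _ : Unit => eC.symm (Sum.inr b')) := by
      ext (i | u) (j | u')
      · simp [hB', Matrix.toBlocks₁₁, Matrix.reindex_apply, hsR, hsC]
      · simp [hB', Matrix.toBlocks₁₂, Matrix.reindex_apply, hsR]
      · simp [hB', Matrix.toBlocks₂₁, Matrix.reindex_apply, hsC]
      · simp [hB', Matrix.toBlocks₂₂, Matrix.reindex_apply]
    rw [hmat]
    exact hmax _ _
  -- the transported affine matrix
  set A' : Matrix (κ ⊕ m) (κ ⊕ m) (MvPolynomial σ R) :=
    P.map C * Matrix.reindex eR eC A * Q.map C with hA'def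
  have hA'aff : ∀ a b, (A' a b).totalDegree ≤ 1 := by
    intro a b
    rw [hA'def, Matrix.mul_apply]
    refine totalDegree_finsetSum_le fun k _ => ?_
    refine (totalDegree_mul _ _).trans ?_
    rw [Matrix.map_apply, totalDegree_C, add_zero, Matrix.mul_apply]
    refine totalDegree_finsetSum_le fun j _ => ?_
    refine (totalDegree_mul _ _).trans ?_
    rw [Matrix.map_apply, totalDegree_C, zero_add, Matrix.reindex_apply, Matrix.submatrix_apply]
    exact hA _ _
  have hCev : ∀ N : Matrix (κ ⊕ m) (κ ⊕ m) R,
      (N.map (C : R → MvPolynomial σ R)).map (eval x) = N := fun N => by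
    ext i j
    simp only [Matrix.map_apply, eval_C]
  have hA'val : A'.map (eval x) = Matrix.fromBlocks 1 0 0 S := by
    rw [hA'def, Matrix.map_mul, Matrix.map_mul, hCev, hCev, ← hPBQ, hB']
    rfl
  -- determinant bookkeeping: `det A' = C u · det A` with `u` a unit
  set ρ : Equiv.Perm (κ ⊕ m) := eC.symm.trans eR with hρ
  set u : R := ((Equiv.Perm.sign ρ : ℤ) : R) * P.det with hudef
  have hunit' : IsUnit u := by
    refine IsUnit.mul ?_ ?_
    · rcases Int.units_eq_one_or (Equiv.Perm.sign ρ) with h | h <;> simp [h]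
    · rw [hPdet]
      exact Matrix.isUnit_det_of_invertible _
  have hdetA' : A'.det = C u * A.det := by
    rw [hA'def, Matrix.det_mul, Matrix.det_mul, det_reindex_eq_sign_mul,
      ← RingHom.mapMatrix_apply, ← RingHom.map_det, ← RingHom.mapMatrix_apply, ← RingHom.map_det,
      hQdet, map_one, mul_one, hudef, map_mul, map_intCast]
    ring
  obtain ⟨w, hw⟩ := hunit'
  set l' : R →ₗ[ℂ] ℂ := l ∘ₗ LinearMap.mulLeft ℂ (↑w⁻¹ : R) with hl'
  have hF' : ∀ d, l' (coeff d A'.det) = coeff d F := by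
    intro d
    rw [hl', LinearMap.comp_apply, LinearMap.mulLeft_apply, hdetA', coeff_C_mul, ← hw, ← mul_assoc,
      Units.inv_mul, one_mul, hF]
  exact H l' A' S hA'aff hF' hA'val hSφ

end MaximalMinor

end Summit.ValiantsHypothesis.ValiantsHypothesis.Theorems.GrenetZeonPolySizeQPAlgebra

end
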